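import Summits.Ventures.PercRepro.C026PFunTwoLiveL2
import Summits.Ventures.PercRepro.C026PFunCurveL2
import Summits.Ventures.PercRepro.C026CFSlack

/-!
# THEOREM L2 is unconditional on forests (p6, gen 17)

On a forest skeleton the cell's class lemma `(CF)` holds for every marks (p5's `cf_any`), so
`0 ≤ slackCF` (`C026CFSlack`), so the corner identity `(E00)` holds (`C026PFunCorner`), so
THEOREM L2 holds unconditionally (`C026PFunTwoLiveL2` for the bare probe, `C026PFunCurveL2` for any
probe): `(P) ≥ 0` at every band state of two live vertices of a forest and of the probe, every other
vertex bare.  With one live vertex the hypothesis `(E00)` is p5's `cf_of_eq_ab`, so CONJECTURE (P)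
holds on EVERY skeleton with at most one live vertex, for every band probe (`pFun_oneLive_nonneg`).
-/

namespace PercRepro

namespace MultiGraph

open Finset

variable {V E : Type*} [Fintype V] [DecidableEq V] [Fintype E] [DecidableEq E]
  {G : MultiGraph V E}

/-- **`(E00)` on every forest**: the k = 2 all-corner value of `(P)` is nonnegative. -/
theorem pFun_liveCells_nonneg_of_forest (hF : G.IsForest) (a b c : V) :
    0 ≤ G.pFun c (liveCells a b) (liveCells a b) univ :=
  pFun_liveCells_nonneg_of_slackCF a b c (slackCF_nonneg_of_forest hF a b c)

/-- **THEOREM L2 on forests, unconditionally** (bare probe): `(P) ≥ 0` at every band state of two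
live vertices `a, b` of a forest skeleton, every other vertex bare. -/
theorem pFun_twoCells_nonneg_of_forest (hF : G.IsForest) (a b c : V) {x₁ K₁ x₂ K₂ : ℝ}
    (hx₁ : 0 ≤ x₁ ∧ x₁ ≤ 1) (hx₂ : 0 ≤ x₂ ∧ x₂ ≤ 1) (hK₁ : kMin x₁ ≤ K₁) (hK₂ : kMin x₂ ≤ K₂) :
    0 ≤ G.pFun c (twoCells a b x₁ x₂) (twoCells a b K₁ K₂) univ :=
  pFun_twoCells_nonneg_of_slackCF a b c (slackCF_nonneg_of_forest hF a b c) hx₁ hx₂ hK₁ hK₂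

/-- **THEOREM L2 on forests with a live probe, unconditionally**: `(P) ≥ 0` at every band state of
the probe and of two live vertices of a forest skeleton, every other vertex bare. -/
theorem pFun_threeCells_nonneg_of_forest (hF : G.IsForest) (a b c : V) {z κ x₁ K₁ x₂ K₂ : ℝ}
    (hz : 0 ≤ z ∧ z ≤ 1) (hκ : kMin z ≤ κ) (hx₁ : 0 ≤ x₁ ∧ x₁ ≤ 1) (hx₂ : 0 ≤ x₂ ∧ x₂ ≤ 1)
    (hK₁ : kMin x₁ ≤ K₁) (hK₂ : kMin x₂ ≤ K₂) :
    0 ≤ G.pFun c (threeCells c a b z x₁ x₂) (threeCells c a b κ K₁ K₂) univ :=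
  pFun_threeCells_nonneg_of_slackCF c a b (slackCF_nonneg_of_forest hF a b c) hz hκ hx₁ hx₂ hK₁ hK₂

/-- `(E00)` with the two live vertices equal, i.e. ONE live vertex, holds on every skeleton
(p5's `cf_of_eq_ab`: `CF a a c`). -/
theorem pFun_liveCells_self_nonneg (a c : V) :
    0 ≤ G.pFun c (liveCells a a) (liveCells a a) univ :=
  pFun_liveCells_nonneg_of_slackCF a a c ((cf_iff_slackCF_nonneg a a c).1
    (@cf_of_eq_ab V E G _ (fun a b => Classical.propDecidable (a = b)) a c))

omit [Fintype V] in
/-- Three-live cells with `b = a` and `x₂ = 1` are the cells of ONE live vertex with a live probe. -/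
theorem threeCells_self_one (c a : V) (z x₁ : ℝ) :
    threeCells c a a z x₁ 1 = fun v => (if v = c then z else 1) * (if v = a then x₁ else 1) := by
  funext v
  simp only [threeCells]
  split_ifs <;> ring

open Classical in
/-- **CONJECTURE (P) holds on every skeleton with at most ONE live vertex, for every band probe**:
the `k ≤ 1` case of `(P)`, unconditionally. -/
theorem pFun_oneLive_nonneg (c a : V) {z κ x₁ K₁ : ℝ} (hz : 0 ≤ z ∧ z ≤ 1) (hκ : kMin z ≤ κ)
    (hx₁ : 0 ≤ x₁ ∧ x₁ ≤ 1) (hK₁ : kMin x₁ ≤ K₁) :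
    0 ≤ G.pFun c (fun v => (if v = c then z else 1) * (if v = a then x₁ else 1))
      (fun v => (if v = c then κ else 1) * (if v = a then K₁ else 1)) univ := by
  rw [← threeCells_self_one, ← threeCells_self_one]
  have h1 : kMin (1 : ℝ) ≤ 1 := by
    unfold kMin
    norm_num
  exact pFun_threeCells_nonneg_of_E00 c a a hz hκ hx₁ (by norm_num) hK₁ h1
    (pFun_liveCells_self_nonneg a c)

end MultiGraph

end PercRepro
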